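import Literature.Analysis.FluidPDE.PlanarPullbackTransport
import Mathlib.Analysis.Calculus.FDeriv.Symmetric
import Mathlib.Analysis.Calculus.ContDiff.Basic
import Mathlib.Algebra.BigOperators.Intervals
import HarnessLib

/-!
# Stream functions and the gluing of simultaneous explicit moves in the plane

Topic `Literature/Analysis/FluidPDE`. Third file of the explicit pullback calculus for the planar
transport equation (`PlanarPullbackKinematics.lean`, `PlanarPullbackTransport.lean`,
`PlanarGraphBandKinematics.lean`). The moves of those files come with **stream functions** `H_k`
(`graphStream`); several moves acting at the same time in disjoint boxes, together with the fluid
at rest elsewhere, are assembled into ONE velocity field by gluing the stream functions through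
cut-offs, `Ĥ = H₀ + Σ_k χ_k (H_k - H₀)`, `V = ∇⊥Ĥ`, and the scalar as `Θ = Σ_k χ_k Θ_k`. This file
provides the calculus of that assembly (folklore; it is how Alberti–Crippa–Mazzucato, JAMS 32
(2019), §§7–8 localise their tubular fields, there with one tube):

* the perpendicular gradient `perpGrad H z = (∂₁H(z), -∂₀H(z))` of a stream function and its basic
  properties: it is local (`perpGrad_congr`), vanishes where `H` is locally constant
  (`perpGrad_eq_zero_of_eventually_const` — the form in which tangency to `∂[0,1]²` and vanishing
  on the boundary strips are obtained), is divergence free for `C²` stream functions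
  (`divergence_perpGrad`, symmetry of second derivatives), and is jointly smooth in `(t, z)` when
  `H` is (`contDiff_uncurry_perpGrad`);
* the field of two components is a perpendicular gradient when its components are `∂₁H`, `-∂₀H`
  (`vec2_eq_perpGrad`), so that the closed-form velocities of the primitive moves ARE `∇⊥` of
  their stream functions;
* locality of the transport expression `∂ₜΘ + D_zΘ[∇⊥H]` (`transportExpr_perpGrad_congr_local`,
  `transport_perpGrad_of_local`, `transport_perpGrad_of_eventually_eq_zero`): if
  `(Θ, H)` agree with `(Θ', H')` near a space-time point, transport of one is transport of the
  other there — the pointwise form of "on the core of element `k` the glued fields are the fields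
  of element `k`";
* the algebra of glued sums along a chain of elements: telescoping cut-offs
  `χ_k = σ_{k} - σ_{k+1}` sum to `σ₀ - σ_K` (`sum_telescopeCutoff`), and a glued sum equals one
  summand near a point where that cut-off is `1` and the others vanish (`glue_eq_of_core`), or
  the common value of two consecutive summands on a junction where their cut-offs add up to `1`
  (`glue_eq_of_junction`); away from all elements it is the background (`glue_eq_of_far`).

Nothing here is specific to the quasi-self-similar construction; the file states no named fact.
It is infrastructure towards a discharge of `acm_compatible_blocks`
(`QuasiSelfSimilarCompatibleBlocks.lean`).

## References

* G. Alberti, G. Crippa, A. L. Mazzucato, *Exponential self-similar mixing by incompressible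
  flows*, J. Amer. Math. Soc. 32 (2019), 445–490, §§7–8 (arXiv:1605.02090).
* E. Bruè, C. De Lellis, *Anomalous dissipation for the forced 3D Navier–Stokes equations*,
  Comm. Math. Phys. 400 (2023), 1507–1533, §4 (arXiv:2207.06301).
-/

noncomputable section

open Function Set Filter
open scoped Topology ContDiff

namespace Literature.Analysis.FluidPDE

namespace PlanarKinematics

/-- The plane `ℝ²` as a Euclidean space. [folklore] -/
local notation "E²" => EuclideanSpace ℝ (Fin 2)

variable {G : Type*} [NormedAddCommGroup G] [NormedSpace ℝ G]

/-! ## The perpendicular gradient of a stream function -/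

/-- **Perpendicular gradient** of a stream function: `∇⊥H(z) = (∂₁H(z), -∂₀H(z))`, written with
Fréchet derivatives along the two basis vectors. [folklore] -/
def perpGrad (H : E² → ℝ) (z : E²) : E² :=
  vec2 (fderiv ℝ H z (EuclideanSpace.single 1 1)) (-fderiv ℝ H z (EuclideanSpace.single 0 1))

/-- Unfolding the perpendicular gradient. [folklore] -/
theorem perpGrad_apply (H : E² → ℝ) (z : E²) :
    perpGrad H z =
      vec2 (fderiv ℝ H z (EuclideanSpace.single 1 1)) (-fderiv ℝ H z (EuclideanSpace.single 0 1)) :=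
  rfl

/-- **`∇⊥` is local**: stream functions that agree near `z` have the same perpendicular gradient
at `z`. [folklore] -/
theorem perpGrad_congr {H H' : E² → ℝ} {z : E²} (h : H =ᶠ[𝓝 z] H') : perpGrad H z = perpGrad H' z := by
  rw [perpGrad_apply, perpGrad_apply, h.fderiv_eq]

/-- **A locally constant stream function generates no motion**: if `H` is constant near `z`, then
`∇⊥H(z) = 0`. Applied near the boundary of the square away from the gate windows (where the glued
stream function is the constant `H₀`) this gives the vanishing — in particular the tangency — of
the glued velocity there. [folklore] -/
theorem perpGrad_eq_zero_of_eventually_const {H : E² → ℝ} {z : E²} {c : ℝ}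
    (h : H =ᶠ[𝓝 z] fun _ => c) : perpGrad H z = 0 := by
  rw [perpGrad_congr h, perpGrad_apply, fderiv_const_apply]  -- fderiv of a constant function
  simp [vec2_eq_zero_iff]

/-- **A field with components `(∂₁H, -∂₀H)` is `∇⊥H`** (the form in which the closed-form
velocities of the primitive moves are recognised as perpendicular gradients, cf.
`graphVelocity_eq_perp_fderiv_graphStream`). [folklore] -/
theorem vec2_eq_perpGrad {H : E² → ℝ} {z : E²} {a b : ℝ}
    (ha : a = fderiv ℝ H z (EuclideanSpace.single 1 1))
    (hb : b = -fderiv ℝ H z (EuclideanSpace.single 0 1)) : vec2 a b = perpGrad H z := by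
  rw [perpGrad_apply, ha, hb]

/-- **Derivative of a directional derivative**: if `H` has a second derivative at `z` (in the sense
that `w ↦ DH(w)` has Fréchet derivative `D²H(z)` there), then `w ↦ DH(w)[e]` has derivative
`v ↦ D²H(z)[v][e]`. [folklore] -/
theorem hasFDerivAt_fderiv_apply {H : E² → ℝ} {z : E²} {D2 : E² →L[ℝ] E² →L[ℝ] ℝ}
    (h2 : HasFDerivAt (fderiv ℝ H) D2 z) (e : E²) :
    HasFDerivAt (fun w => fderiv ℝ H w e) (D2.flip e) z := by
  have h := h2.clm_apply (hasFDerivAt_const e z)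
  simp only [ContinuousLinearMap.comp_zero, zero_add] at h
  exact h

/-- **Perpendicular gradients are divergence free**: for a stream function that is `C²` at `z`,
`div ∇⊥H (z) = ∂₀∂₁H - ∂₁∂₀H = 0` by the symmetry of second derivatives. [folklore] -/
theorem divergence_perpGrad {H : E² → ℝ} {z : E²} (hH : ContDiffAt ℝ 2 H z) :
    ∑ j, fderiv ℝ (perpGrad H) z (EuclideanSpace.single j 1) j = 0 := by
  -- `H` has a second derivative at `z`, and it is symmetric
  have hdiff : DifferentiableAt ℝ (fderiv ℝ H) z := by
    have h := hH.fderiv_right (m := 1) le_rfl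
    exact h.differentiableAt one_ne_zero
  have h2 : HasFDerivAt (fderiv ℝ H) (fderiv ℝ (fderiv ℝ H) z) z := hdiff.hasFDerivAt
  have hsymm : IsSymmSndFDerivAt ℝ H z := hH.isSymmSndFDerivAt (by simp)
  set D2 := fderiv ℝ (fderiv ℝ H) z with hD2
  have hP : HasFDerivAt (fun w => fderiv ℝ H w (EuclideanSpace.single 1 1))
      (D2.flip (EuclideanSpace.single 1 1)) z := hasFDerivAt_fderiv_apply h2 _
  have hQ : HasFDerivAt (fun w => -fderiv ℝ H w (EuclideanSpace.single 0 1))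
      (-(D2.flip (EuclideanSpace.single 0 1))) z := (hasFDerivAt_fderiv_apply h2 _).neg
  rw [show perpGrad H = fun w => vec2 (fderiv ℝ H w (EuclideanSpace.single 1 1))
      (-fderiv ℝ H w (EuclideanSpace.single 0 1)) from rfl, divergence_vec2 hP hQ]
  simp only [ContinuousLinearMap.flip_apply, neg_apply]
  rw [hsymm (EuclideanSpace.single 0 1) (EuclideanSpace.single 1 1)]
  ring

/-- **Joint smoothness of `∇⊥` of a time-dependent stream function**: if `(t, z) ↦ H(t, z)` is
`C^∞`, so is `(t, z) ↦ ∇⊥(H(t,·))(z)`. [folklore] -/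
theorem contDiff_uncurry_perpGrad {H : ℝ → E² → ℝ} (hH : ContDiff ℝ ∞ (uncurry H)) :
    ContDiff ℝ ∞ (uncurry fun t z => perpGrad (H t) z) := by
  -- the partial derivative in `z` is jointly smooth
  have hf : ContDiff ℝ ∞ (uncurry fun (p : ℝ × E²) (w : E²) => H p.1 w) := by
    have e : (uncurry fun (p : ℝ × E²) (w : E²) => H p.1 w) = uncurry H ∘ fun q : (ℝ × E²) × E² => (q.1.1, q.2) := by
      funext q; rfl
    rw [e]
    exact hH.comp ((contDiff_fst.comp contDiff_fst).prodMk contDiff_snd)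
  have hD : ContDiff ℝ ∞ fun p : ℝ × E² => fderiv ℝ (H p.1) p.2 :=
    hf.fderiv (m := ∞) contDiff_snd (by simp)
  have h1 : ContDiff ℝ ∞ fun p : ℝ × E² => fderiv ℝ (H p.1) p.2 (EuclideanSpace.single 1 1) :=
    hD.clm_apply contDiff_const
  have h0 : ContDiff ℝ ∞ fun p : ℝ × E² => -fderiv ℝ (H p.1) p.2 (EuclideanSpace.single 0 1) :=
    (hD.clm_apply contDiff_const).neg
  have e : (uncurry fun t z => perpGrad (H t) z) = fun p : ℝ × E² =>
      vec2 (fderiv ℝ (H p.1) p.2 (EuclideanSpace.single 1 1))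
        (-fderiv ℝ (H p.1) p.2 (EuclideanSpace.single 0 1)) := by
    funext p; rfl
  rw [e]
  exact contDiff_vec2 h1 h0

/-- The stream function slice `H(t, ·)` of a jointly smooth `H` is `C²` (indeed smooth) at every
point — the hypothesis of `divergence_perpGrad`. [folklore] -/
theorem contDiffAt_slice_of_contDiff_uncurry {H : ℝ → E² → ℝ} (hH : ContDiff ℝ ∞ (uncurry H))
    (t : ℝ) (z : E²) : ContDiffAt ℝ 2 (H t) z := by
  have h : ContDiff ℝ ∞ (H t) := hH.comp (contDiff_const.prodMk contDiff_id)
  exact (h.of_le (by norm_cast)).contDiffAt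

/-- **The glued velocity of a jointly smooth stream function is divergence free everywhere.**
[folklore] -/
theorem divergence_perpGrad_of_contDiff_uncurry {H : ℝ → E² → ℝ} (hH : ContDiff ℝ ∞ (uncurry H))
    (t : ℝ) (z : E²) : ∑ j, fderiv ℝ (perpGrad (H t)) z (EuclideanSpace.single j 1) j = 0 :=
  divergence_perpGrad (contDiffAt_slice_of_contDiff_uncurry hH t z)

/-! ## Locality of the transport expression -/

/-- **Transport is local**: if the scalar fields `Θ`, `Θ'` agree on a space-time neighbourhood of
`(t, z)` and the stream functions `H(t,·)`, `H'(t,·)` agree near `z`, then the transport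
expression `∂ₜΘ + D_zΘ[∇⊥H]` of the first pair at `(t,z)` is that of the second. This is the
pointwise form of the statement "on the core of element `k` the glued fields are the fields of
element `k`". [folklore] -/
theorem transportExpr_perpGrad_congr_local {Θ Θ' : ℝ → E² → G} {H H' : E² → ℝ} {t : ℝ} {z : E²}
    (hΘ : ∀ᶠ p in 𝓝 (t, z), Θ p.1 p.2 = Θ' p.1 p.2) (hH : H =ᶠ[𝓝 z] H') :
    deriv (fun s => Θ s z) t + fderiv ℝ (Θ t) z (perpGrad H z) =
      deriv (fun s => Θ' s z) t + fderiv ℝ (Θ' t) z (perpGrad H' z) := by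
  have ht : Tendsto (fun s : ℝ => (s, z)) (𝓝 t) (𝓝 (t, z)) :=
    tendsto_id.prodMk_nhds tendsto_const_nhds
  have hz : Tendsto (fun w : E² => (t, w)) (𝓝 z) (𝓝 (t, z)) :=
    tendsto_const_nhds.prodMk_nhds tendsto_id
  have h1 : (fun s => Θ s z) =ᶠ[𝓝 t] fun s => Θ' s z := (ht.eventually hΘ).mono fun s hs => hs
  have h2 : Θ t =ᶠ[𝓝 z] Θ' t := (hz.eventually hΘ).mono fun w hw => hw
  rw [h1.deriv_eq, h2.fderiv_eq, perpGrad_congr hH]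

/-- **Transport on a core**: if `(Θ, H)` agree with `(Θ_k, H_k)` near `(t, z)` and `Θ_k` is
transported by `∇⊥H_k` at `(t, z)`, then `Θ` is transported by `∇⊥H` there. [folklore] -/
theorem transport_perpGrad_of_local {Θ Θk : ℝ → E² → G} {H Hk : E² → ℝ} {t : ℝ} {z : E²}
    (hΘ : ∀ᶠ p in 𝓝 (t, z), Θ p.1 p.2 = Θk p.1 p.2) (hH : H =ᶠ[𝓝 z] Hk)
    (hk : deriv (fun s => Θk s z) t + fderiv ℝ (Θk t) z (perpGrad Hk z) = 0) :
    deriv (fun s => Θ s z) t + fderiv ℝ (Θ t) z (perpGrad H z) = 0 := by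
  rw [transportExpr_perpGrad_congr_local hΘ hH, hk]

/-- **Transport on a collar / away from the tubes**: where `Θ` vanishes on a space-time
neighbourhood, it is transported by any velocity, in particular by the glued `∇⊥H` whatever `H`
does there. [folklore] -/
theorem transport_perpGrad_of_eventually_eq_zero {Θ : ℝ → E² → G} (H : ℝ → E² → ℝ) {t : ℝ} {z : E²}
    (h : ∀ᶠ p in 𝓝 (t, z), Θ p.1 p.2 = 0) :
    deriv (fun s => Θ s z) t + fderiv ℝ (Θ t) z (perpGrad (H t) z) = 0 :=
  transportExpr_eq_zero_of_eventually_eq_zero (fun s w => perpGrad (H s) w) h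

/-! ## Glued sums along a chain of elements -/

section Glue

variable {X : Type*}

/-- **Telescoping cut-offs**: with longitudinal steps `σ₀, σ₁, …, σ_K` (each `σ_j` is `0` before
the `j`-th junction along the path and `1` after it), the cut-offs `χ_k = σ_k - σ_{k+1}` of the
`K` elements sum to `σ₀ - σ_K`; with `σ₀ ≡ 1` and `σ_K ≡ 0` on the region of interest this is the
partition of unity along the chain. [folklore] -/
theorem sum_telescopeCutoff (σ : ℕ → X → ℝ) (K : ℕ) (x : X) :
    ∑ k ∈ Finset.range K, (σ k x - σ (k + 1) x) = σ 0 x - σ K x := by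
  exact Finset.sum_range_sub' (fun k => σ k x) K

/-- **The glued scalar** `Θ = Σ_k χ_k Θ_k` of a chain of `K` elements. [folklore] -/
def glueScalar (K : ℕ) (χ : ℕ → X → ℝ) (Θ : ℕ → X → ℝ) (x : X) : ℝ :=
  ∑ k ∈ Finset.range K, χ k x * Θ k x

/-- **The glued stream function** `Ĥ = H₀ + Σ_k χ_k (H_k - H₀)` of a chain of `K` elements over
the background constant `H₀` (fluid at rest). [folklore] -/
def glueStream (K : ℕ) (H₀ : ℝ) (χ : ℕ → X → ℝ) (H : ℕ → X → ℝ) (x : X) : ℝ :=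
  H₀ + ∑ k ∈ Finset.range K, χ k x * (H k x - H₀)

/-- Unfolding the glued scalar. [folklore] -/
theorem glueScalar_apply (K : ℕ) (χ Θ : ℕ → X → ℝ) (x : X) :
    glueScalar K χ Θ x = ∑ k ∈ Finset.range K, χ k x * Θ k x := rfl

/-- Unfolding the glued stream function. [folklore] -/
theorem glueStream_apply (K : ℕ) (H₀ : ℝ) (χ H : ℕ → X → ℝ) (x : X) :
    glueStream K H₀ χ H x = H₀ + ∑ k ∈ Finset.range K, χ k x * (H k x - H₀) := rfl

/-- **A glued sum on a core**: at a point where the cut-off of element `k` is `1` and all other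
cut-offs vanish, the glued scalar is `Θ_k` and the glued stream function is `H_k`. [folklore] -/
theorem glue_eq_of_core {K : ℕ} {χ Θ H : ℕ → X → ℝ} {H₀ : ℝ} {x : X} {k : ℕ} (hk : k < K)
    (h1 : χ k x = 1) (h0 : ∀ j < K, j ≠ k → χ j x = 0) :
    glueScalar K χ Θ x = Θ k x ∧ glueStream K H₀ χ H x = H k x := by
  have hmem : k ∈ Finset.range K := Finset.mem_range.2 hk
  have hS : ∀ f : ℕ → ℝ, ∑ j ∈ Finset.range K, χ j x * f j = f k := by
    intro f
    rw [Finset.sum_eq_single_of_mem k hmem]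
    · rw [h1, one_mul]
    · intro j hj hjk
      rw [h0 j (Finset.mem_range.1 hj) hjk, zero_mul]
  refine ⟨by rw [glueScalar_apply, hS], ?_⟩
  rw [glueStream_apply, hS (fun j => H j x - H₀)]
  ring

/-- **A glued sum on a junction**: at a point where two consecutive elements `k`, `k+1` carry
cut-offs adding up to `1`, all other cut-offs vanish, and the two elements agree (`Θ_k = Θ_{k+1}`,
`H_k = H_{k+1}`, as on the junction zone of consecutive elements of an explicit move), the glued
scalar is `Θ_k` and the glued stream function is `H_k`. [folklore] -/
theorem glue_eq_of_junction {K : ℕ} {χ Θ H : ℕ → X → ℝ} {H₀ : ℝ} {x : X} {k : ℕ} (hk : k + 1 < K)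
    (h1 : χ k x + χ (k + 1) x = 1) (h0 : ∀ j < K, j ≠ k → j ≠ k + 1 → χ j x = 0)
    (hΘ : Θ (k + 1) x = Θ k x) (hH : H (k + 1) x = H k x) :
    glueScalar K χ Θ x = Θ k x ∧ glueStream K H₀ χ H x = H k x := by
  have hk' : k < K := by omega
  have hS : ∀ f : ℕ → ℝ, f (k + 1) = f k → ∑ j ∈ Finset.range K, χ j x * f j = f k := by
    intro f hf
    have hsub : ({k, k + 1} : Finset ℕ) ⊆ Finset.range K := by
      intro j hj
      rcases Finset.mem_insert.1 hj with rfl | hj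
      · exact Finset.mem_range.2 hk'
      · rw [Finset.mem_singleton.1 hj]; exact Finset.mem_range.2 hk
    rw [← Finset.sum_subset hsub]
    · rw [Finset.sum_pair (by omega : k ≠ k + 1), hf, ← add_mul, h1, one_mul]
    · intro j hj hjn
      have hj' : j ≠ k ∧ j ≠ k + 1 := by simpa [Finset.mem_insert, Finset.mem_singleton] using hjn
      rw [h0 j (Finset.mem_range.1 hj) hj'.1 hj'.2, zero_mul]
  refine ⟨by rw [glueScalar_apply, hS _ hΘ], ?_⟩
  rw [glueStream_apply, hS (fun j => H j x - H₀) (by simp only [hH])]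
  ring

/-- **A glued sum away from all elements**: where every cut-off vanishes, the glued scalar is `0`
and the glued stream function is the background constant `H₀`. [folklore] -/
theorem glue_eq_of_far {K : ℕ} {χ Θ H : ℕ → X → ℝ} {H₀ : ℝ} {x : X} (h0 : ∀ j < K, χ j x = 0) :
    glueScalar K χ Θ x = 0 ∧ glueStream K H₀ χ H x = H₀ := by
  have hS : ∀ f : ℕ → ℝ, ∑ j ∈ Finset.range K, χ j x * f j = 0 := fun f =>
    Finset.sum_eq_zero fun j hj => by rw [h0 j (Finset.mem_range.1 hj), zero_mul]
  exact ⟨by rw [glueScalar_apply, hS], by rw [glueStream_apply, hS, add_zero]⟩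

/-- **Local versions.** If the hypotheses of `glue_eq_of_core` hold on a set `s`, the glued
scalar and stream function agree with `Θ_k`, `H_k` on `s` (to be used with `s` a neighbourhood,
feeding `transport_perpGrad_of_local` and `perpGrad_congr`). [folklore] -/
theorem glue_eqOn_of_core {K : ℕ} {χ Θ H : ℕ → X → ℝ} {H₀ : ℝ} {s : Set X} {k : ℕ} (hk : k < K)
    (h1 : ∀ x ∈ s, χ k x = 1) (h0 : ∀ x ∈ s, ∀ j < K, j ≠ k → χ j x = 0) :
    EqOn (glueScalar K χ Θ) (Θ k) s ∧ EqOn (glueStream K H₀ χ H) (H k) s :=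
  ⟨fun x hx => (glue_eq_of_core (Θ := Θ) (H := H) (H₀ := H₀) hk (h1 x hx) (h0 x hx)).1,
    fun x hx => (glue_eq_of_core (Θ := Θ) (H := H) (H₀ := H₀) hk (h1 x hx) (h0 x hx)).2⟩

/-- Local version of `glue_eq_of_far`: where all cut-offs vanish on `s`, the glued scalar
vanishes and the glued stream function is the constant `H₀` on `s`. [folklore] -/
theorem glue_eqOn_of_far {K : ℕ} {χ Θ H : ℕ → X → ℝ} {H₀ : ℝ} {s : Set X}
    (h0 : ∀ x ∈ s, ∀ j < K, χ j x = 0) :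
    EqOn (glueScalar K χ Θ) (fun _ => 0) s ∧ EqOn (glueStream K H₀ χ H) (fun _ => H₀) s :=
  ⟨fun x hx => (glue_eq_of_far (Θ := Θ) (H := H) (H₀ := H₀) (h0 x hx)).1,
    fun x hx => (glue_eq_of_far (Θ := Θ) (H := H) (H₀ := H₀) (h0 x hx)).2⟩

end Glue

end PlanarKinematics

end Literature.Analysis.FluidPDE
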